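import Literature.MathematicalPhysics.QuantumFieldTheory.Balaban1983to89.Beta.WilsonWardJets2

/-!
# The order-`B²` Ward identity of the Wilson plaquette jets, second order in `W`, ENTRYWISE: sixteen kernel-certified matrix entries

HONEST FRAMING (cell `pub-balaban`, β sub-cell, lineage an3; verbatim): discharging `BetaPertH` makes Bałaban's UV stability
UNCONDITIONAL — a real constructive-QFT result; it is NOT the continuum limit and NOT the Clay problem.  This file discharges NOTHING
of `BetaPertH`.  ABSOLUTE RULE of the cell (verbatim): «No internally-minted statement may enter as a cited fact. Every hypothesis is
either kernel-proved in this package or a verbatim quotation of a PUBLISHED theorem with page reference. The manuscript(s) under audit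
are NOT citable for their own disputed steps — they are the thing under adjudication; programme-internal (2001/route/tribunal) claims
are never citable.»  Accordingly every declaration below is kernel-proved here from the imports; NOTHING is cited; no `def … : Prop`
occurs at all (no `def` at all).

## What is proved

Third file of the Ward series of the Wilson plaquette jets (`Beta.WilsonWardJets`: orders `B⁰`, `B¹`; `Beta.WilsonWardJets2`: order
`B²` first order in `W` + the integer closed forms used below; read their headers for the setting, the chart `U_b = e^{W_b}·e^{B_b}` of
[Balaban1985BackgroundPropagators] (3.1) p. 390 = `Beta.WilsonVertex.plaq`, the corners `x₁ → x₂ → x₃ ← x₄ ← x₁` and bonds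
`b₁ : x₁ → x₂`, `b₂ : x₂ → x₃`, `b₃ : x₄ → x₃`, `b₄ : x₁ → x₄`, and the jets `F_{2,2} = τ∘P22`, `F_{2,1} = τ∘P21`, `F_{2,0} = τ∘quad∘wpart`,
`F_{1,2} = τ∘P12`, `F_{1,1} = τ∘P11`).  The ORDER-`B²` WARD IDENTITY, SECOND ORDER IN `W` — per plaquette, all letters —

  `4·Pol F_{2,2}(h, W₀λ) + 4·Pol F_{2,1}(h, W₁(B)λ) + 2·Pol F_{2,0}(h, 2W₂(B)λ) = 2·F_{1,2}(N₀(h)λ) + 2·F_{1,1}(N₁(h)λ)`     (E₂)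

(`Pol f(h,v) = f(h+v) − f(h) − f(v)`; gauge directions `W₀λ = λ(b₋) − λ(b₊)`, `W₁(B)λ = −[B_b, λ(b₊)]`, `2W₂(B)λ = −[B_b,[B_b,λ(b₊)]]`;
current arguments `N₀(h)λ = [h_b, λ(b₋)+λ(b₊)]`, `N₁(h)λ = [h_b,[B_b,λ(b₊)]]`) is BILINEAR in the pair `(h, λ)`.  This file proves
its SIXTEEN MATRIX ENTRIES `ward22_b{a}_x{k}` (`a, k ∈ {1,2,3,4}`): `h` supported on the single bond `b_a` (an arbitrary letter
`h ∈ 𝔸` there, `0` elsewhere) and `λ` supported at the single corner `x_k` (an arbitrary letter `l ∈ 𝔸` there), for EVERY ring `𝔸`,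
every `𝕜`-linear TRACIAL `τ`, all `B₁, …, B₄, h, l`.  These are exactly the entries a matrix reading `S₂ *ᵥ w + Nᵀ *ᵥ s₁ = 0` (the
shape of hypothesis (I1) of `Beta.LagrangianGaugeDegeneracy`: rows = bond directions of the plaquette, columns = corner gauge
parameters) consumes; the all-letters form (E₂) is their bilinear span and is deliberately NOT restated as a theorem (its one-shot
commutator certificate — a 933-monomial difference in twelve letters — exceeds the normaliser's budget, `noncomm_ring` at 4·10⁶
heartbeats, whereas the entries have collected differences of 6 … 132 monomials).  In each statement the groups that vanish
IDENTICALLY for that entry are omitted: for `λ` at the base corner `x₁` no bond of the word ENDS at the corner, so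
`W₁λ = W₂λ = N₁ = 0` and only the `F_{2,2}` group appears on the Hessian side; the current side is `0` unless `b_a` touches `x_k`
(`F_{1,2}`-term iff `x_k ∈ {b₋, b₊}`, `F_{1,1}`-term iff `x_k = b₊`).  Letters: `W₀λ` puts `l` on the bonds STARTING at `x_k` and `−l`
on those ENDING there; `W₁(B)λ = l·B_b − B_b·l` and `2W₂(B)λ = B_b·(l·B_b − B_b·l) − (l·B_b − B_b·l)·B_b` on the bonds ending at
`x_k`; `N₀ = h·l − l·h`; `N₁ = (l·B_b − B_b·l)·h − h·(l·B_b − B_b·l)`.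

METHOD, uniform over the sixteen entries: the integer closed forms `WilsonWardJets2.four_smul_trace_P22` / `four_smul_trace_P21` /
`two_smul_trace_P12` / `two_smul_trace_P11`, `WilsonWardJets.two_smul_trace_quad`, `WilsonWardJets2.two_smul_twist₂_plaq`,
`WilsonVertex2.two_smul_qtwistAux` with the recursion of `ctwistAux`, then ONE ring identity `inside_L − inside_R = Σ_a [a, P_a]`
over the six letters against an explicit certificate (`WilsonWardJets.csum`, grouped by the left letter; 671 certificate monomials in
all = the size of the certificate of (E₂) itself), checked by `noncomm_ring`, and `τ` kills the commutators
(`WilsonWardJets.trace_eq_of_sub_eq_csum` / `trace_eq_zero_of_eq_csum`).  Statements, certificates and scripts were generated by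
the archived exact engine `records/ward2/entries_gen.py` + `make_entries.py` (free algebra over `ℚ`, each entry's difference
cyclically zero); the kernel re-verifies every ring identity and trusts nothing.  `maxHeartbeats` is raised per theorem (uniformly;
most entries need far less).

## Why (dictionary to `Beta.LagrangianGaugeDegeneracy`, hypothesis (I1), order `B²`)

`Beta.WilsonWardJets` §Why gives the graded reading `Σ_{j+k=n} 2·Pol F_{2,j}(h, W_kλ) = Σ_{j+k=n} F_{1,j}(N_k(h)λ)` of (I1) for the
Wilson jets; `n = 0, 1` are `WilsonWardJets.ward20` / `ward21`, and `n = 2` is (E₂), delivered here entrywise (with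
`F_{1,0}(N₂λ) = 0` dropped: `WilsonWardJets.trace_wsum_plaq_comm`).  PROVENANCE (not used in proofs): invariance of `τ(U(∂p))` under
`U_b ↦ u(x_{b₋}) U_b u(x_{b₊})⁻¹`, `u = e^{λ}`, second variation, `B`-degree two.

## What this file does NOT do

It does not restate (E₂) for all letters at once (bilinear span of the entries, see above); nothing at order `B³` or higher; nothing
about the minimiser manifold, the hypotheses (K2), (L) of `Beta.LagrangianGaugeDegeneracy`, (c1)–(c3) of `Beta.GaugeFixing`, the
matrix bookkeeping of (I1) itself, or any estimate; it moves no wall statement; it is not summit progress, not the continuum limit,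
not Clay.  [folklore] throughout: multilinear algebra in an arbitrary normed algebra.
-/

namespace Literature.MathematicalPhysics.QuantumFieldTheory.Balaban1983to89.Beta.WilsonWardEntries2

open Literature.MathematicalPhysics.QuantumFieldTheory.Balaban1983to89.Beta.TransportVertices
open Literature.MathematicalPhysics.QuantumFieldTheory.Balaban1983to89.Beta.WilsonVertex
open Literature.MathematicalPhysics.QuantumFieldTheory.Balaban1983to89.Beta.WilsonVertex2
open Literature.MathematicalPhysics.QuantumFieldTheory.Balaban1983to89.Beta.SpinTable (br)
open Literature.MathematicalPhysics.QuantumFieldTheory.Balaban1983to89.Beta.WilsonWardJets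
  (csum csum_nil csum_cons trace_eq_of_sub_eq_csum trace_eq_zero_of_eq_csum two_smul_trace_quad)
open Literature.MathematicalPhysics.QuantumFieldTheory.Balaban1983to89.Beta.WilsonWardJets2
  (two_smul_twist₂_plaq four_smul_trace_P22 four_smul_trace_P21 two_smul_trace_P12 two_smul_trace_P11)

/-! ## The sixteen entries `ward22_b{a}_x{k}` (see the header: `h` on `b_a`, `λ = l` at `x_k`; only the groups that do not vanish identically are listed) -/
section Entries

variable (𝕜 : Type*) [RCLike 𝕜] {𝔸 : Type*} [NormedRing 𝔸] [NormedAlgebra 𝕜 𝔸]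
variable {V : Type*} [AddCommGroup V] [Module 𝕜 V]
variable (τ : 𝔸 →ₗ[𝕜] V) (B₁ B₂ B₃ B₄ h l : 𝔸)

set_option maxHeartbeats 2000000 in
/-- **Entry `(b_1, x_1)`** of the order-`B²` Ward identity (`h` on `b₁ : x₁ → x₂` only, `λ = l` at the corner `x_1` only; `x_1 = b₋`): Hessian side `F_{2,2}` only (`W₁λ = W₂λ = 0`: no bond of the word ends at `x₁`); current side `2·F_{1,2}(N₀)`.  Collected difference 20 monomials, certificate 30. [folklore] -/
theorem ward22_b1_x1 (hτ : ∀ a b : 𝔸, τ (a * b) = τ (b * a)) :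
    (4 : 𝕜) • τ (P22 𝕜 (plaq (h + l) 0 0 l B₁ B₂ B₃ B₄))
      - (4 : 𝕜) • τ (P22 𝕜 (plaq h 0 0 0 B₁ B₂ B₃ B₄))
      - (4 : 𝕜) • τ (P22 𝕜 (plaq l 0 0 l B₁ B₂ B₃ B₄)) =
      (2 : 𝕜) • τ (P12 𝕜 (plaq (h * l - l * h) 0 0 0 B₁ B₂ B₃ B₄)) := by
  simp only [four_smul_trace_P22 𝕜 τ hτ, two_smul_trace_P12 𝕜 τ, two_smul_twist₂_plaq, two_smul_qtwistAux, wpart_plaq, bpart_plaq,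
    twist_plaq, sum_four_signed, two_smul_quad, commSum_four]
  simp only [plaq, ctwistAux_consW, ctwistAux_consB, ctwistAux_nil, twistAux_consW, twistAux_consB, twistAux_nil, wpart_consW,
    wpart_consB, wpart_nil, List.sum_cons, List.sum_nil]
  simp only [← map_add, ← map_sub]
  refine trace_eq_of_sub_eq_csum 𝕜 τ hτ
    [(B₁,
      4 * (B₃ * l * h) + 4 * (B₄ * l * h) - 2 * (B₁ * l * h) - 4 * (B₂ * l * h) - 2 * (l * h * B₁)),
    (B₂,
      4 * (B₃ * l * h) + 4 * (B₄ * l * h) - 2 * (B₂ * l * h) - 4 * (l * h * B₁) - 2 * (l * h * B₂)),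
    (B₃,
      4 * (l * h * B₁) + 4 * (l * h * B₂) - 2 * (B₃ * l * h) - 4 * (B₄ * l * h) - 2 * (l * h * B₃)),
    (B₄,
      4 * (l * h * B₁) + 4 * (l * h * B₂) - 2 * (B₄ * l * h) - 4 * (l * h * B₃) - 2 * (l * h * B₄)),
    (h,
      4 * (B₁ * B₃ * l) + 4 * (B₁ * B₄ * l) + 4 * (B₂ * B₃ * l) + 4 * (B₂ * B₄ * l) - 2 * (B₁ * B₁ * l) - 4 * (B₁ * B₂ * l) - 2 * (B₂ * B₂ * l) - 2 * (B₃ * B₃ * l) - 4 * (B₃ * B₄ * l) - 2 * (B₄ * B₄ * l))] ?_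
  simp only [csum_cons, csum_nil, br]
  noncomm_ring

set_option maxHeartbeats 2000000 in
/-- **Entry `(b_1, x_2)`** of the order-`B²` Ward identity (`h` on `b₁ : x₁ → x₂` only, `λ = l` at the corner `x_2` only; `x_2 = b₊`): Hessian side `F_{2,2}`, `F_{2,1}`, `F_{2,0}`; current side `2·F_{1,2}(N₀)` + `2·F_{1,1}(N₁)`.  Collected difference 6 monomials, certificate 5. [folklore] -/
theorem ward22_b1_x2 (hτ : ∀ a b : 𝔸, τ (a * b) = τ (b * a)) :
    (4 : 𝕜) • τ (P22 𝕜 (plaq (h - l) l 0 0 B₁ B₂ B₃ B₄))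
      - (4 : 𝕜) • τ (P22 𝕜 (plaq h 0 0 0 B₁ B₂ B₃ B₄))
      - (4 : 𝕜) • τ (P22 𝕜 (plaq (-l) l 0 0 B₁ B₂ B₃ B₄))
      + ((4 : 𝕜) • τ (P21 𝕜 (plaq (h + (l * B₁ - B₁ * l)) 0 0 0 B₁ B₂ B₃ B₄))
          - (4 : 𝕜) • τ (P21 𝕜 (plaq h 0 0 0 B₁ B₂ B₃ B₄))
          - (4 : 𝕜) • τ (P21 𝕜 (plaq (l * B₁ - B₁ * l) 0 0 0 B₁ B₂ B₃ B₄)))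
      + ((2 : 𝕜) • τ (quad 𝕜 (wpart (plaq (h + (B₁ * (l * B₁ - B₁ * l) - (l * B₁ - B₁ * l) * B₁)) 0 0 0 B₁ B₂ B₃ B₄)))
          - (2 : 𝕜) • τ (quad 𝕜 (wpart (plaq h 0 0 0 B₁ B₂ B₃ B₄)))
          - (2 : 𝕜) • τ (quad 𝕜 (wpart (plaq (B₁ * (l * B₁ - B₁ * l) - (l * B₁ - B₁ * l) * B₁) 0 0 0 B₁ B₂ B₃ B₄)))) =
      (2 : 𝕜) • τ (P12 𝕜 (plaq (h * l - l * h) 0 0 0 B₁ B₂ B₃ B₄)) + (2 : 𝕜) • τ (P11 (plaq ((l * B₁ - B₁ * l) * h - h * (l * B₁ - B₁ * l)) 0 0 0 B₁ B₂ B₃ B₄)) := by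
  simp only [four_smul_trace_P22 𝕜 τ hτ, four_smul_trace_P21 𝕜 τ hτ, two_smul_trace_quad 𝕜 τ, two_smul_trace_P12 𝕜 τ,
    two_smul_trace_P11 𝕜 τ, two_smul_twist₂_plaq, two_smul_qtwistAux, wpart_plaq, bpart_plaq, twist_plaq, sum_four_signed,
    two_smul_quad, commSum_four]
  simp only [plaq, ctwistAux_consW, ctwistAux_consB, ctwistAux_nil, twistAux_consW, twistAux_consB, twistAux_nil, wpart_consW,
    wpart_consB, wpart_nil, List.sum_cons, List.sum_nil]
  simp only [← map_add, ← map_sub]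
  refine trace_eq_of_sub_eq_csum 𝕜 τ hτ
    [(B₁,
      -(B₁ * h * l) - h * l * B₁),
    (h,
      B₁ * B₁ * l - 2 * (B₁ * l * B₁)),
    (l,
      -(B₁ * B₁ * h))] ?_
  simp only [csum_cons, csum_nil, br]
  noncomm_ring

set_option maxHeartbeats 2000000 in
/-- **Entry `(b_1, x_3)`** of the order-`B²` Ward identity (`h` on `b₁ : x₁ → x₂` only, `λ = l` at the corner `x_3` only; the bond does not touch `x_3`): Hessian side `F_{2,2}`, `F_{2,1}`, `F_{2,0}`; current side `0`.  Collected difference 64 monomials, certificate 40. [folklore] -/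
theorem ward22_b1_x3 (hτ : ∀ a b : 𝔸, τ (a * b) = τ (b * a)) :
    (4 : 𝕜) • τ (P22 𝕜 (plaq h (-l) (-l) 0 B₁ B₂ B₃ B₄))
      - (4 : 𝕜) • τ (P22 𝕜 (plaq h 0 0 0 B₁ B₂ B₃ B₄))
      - (4 : 𝕜) • τ (P22 𝕜 (plaq 0 (-l) (-l) 0 B₁ B₂ B₃ B₄))
      + ((4 : 𝕜) • τ (P21 𝕜 (plaq h (l * B₂ - B₂ * l) (l * B₃ - B₃ * l) 0 B₁ B₂ B₃ B₄))
          - (4 : 𝕜) • τ (P21 𝕜 (plaq h 0 0 0 B₁ B₂ B₃ B₄))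
          - (4 : 𝕜) • τ (P21 𝕜 (plaq 0 (l * B₂ - B₂ * l) (l * B₃ - B₃ * l) 0 B₁ B₂ B₃ B₄)))
      + ((2 : 𝕜) • τ (quad 𝕜 (wpart (plaq h (B₂ * (l * B₂ - B₂ * l) - (l * B₂ - B₂ * l) * B₂) (B₃ * (l * B₃ - B₃ * l) - (l * B₃ - B₃ * l) * B₃) 0 B₁ B₂ B₃ B₄)))
          - (2 : 𝕜) • τ (quad 𝕜 (wpart (plaq h 0 0 0 B₁ B₂ B₃ B₄)))
          - (2 : 𝕜) • τ (quad 𝕜 (wpart (plaq 0 (B₂ * (l * B₂ - B₂ * l) - (l * B₂ - B₂ * l) * B₂) (B₃ * (l * B₃ - B₃ * l) - (l * B₃ - B₃ * l) * B₃) 0 B₁ B₂ B₃ B₄)))) =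
      0 := by
  simp only [four_smul_trace_P22 𝕜 τ hτ, four_smul_trace_P21 𝕜 τ hτ, two_smul_trace_quad 𝕜 τ, two_smul_twist₂_plaq,
    two_smul_qtwistAux, wpart_plaq, bpart_plaq, twist_plaq, sum_four_signed, two_smul_quad, commSum_four]
  simp only [plaq, ctwistAux_consW, ctwistAux_consB, ctwistAux_nil, twistAux_consW, twistAux_consB, twistAux_nil, wpart_consW,
    wpart_consB, wpart_nil, List.sum_cons, List.sum_nil]
  simp only [← map_add, ← map_sub]
  refine trace_eq_zero_of_eq_csum 𝕜 τ hτ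
    [(B₁,
      2 * (B₂ * l * h) + 2 * (h * B₃ * l) + 2 * (h * l * B₂) + 2 * (l * B₃ * h) - 2 * (B₃ * l * h) - 2 * (h * B₂ * l) - 2 * (h * l * B₃) - 2 * (l * B₂ * h)),
    (B₂,
      2 * (B₂ * l * h) + 2 * (h * l * B₂) - 2 * (B₃ * l * h) - 2 * (h * B₄ * l) - 2 * (h * l * B₃) - 2 * (l * B₄ * h)),
    (B₃,
      2 * (B₃ * l * h) + 2 * (h * B₄ * l) + 2 * (h * l * B₃) + 2 * (l * B₄ * h) - 2 * (B₂ * l * h) - 2 * (h * l * B₂)),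
    (B₄,
      2 * (B₃ * l * h) + 2 * (h * l * B₃) - 2 * (B₂ * l * h) - 2 * (h * l * B₂)),
    (h,
      2 * (B₂ * l * B₂) + 2 * (B₃ * l * B₃) + 2 * (B₃ * l * B₄) + 2 * (B₄ * l * B₃) - 2 * (B₂ * l * B₃) - 2 * (B₂ * l * B₄) - 2 * (B₃ * l * B₂) - 2 * (B₄ * l * B₂)),
    (l,
      2 * (B₂ * h * B₂) + 2 * (B₃ * h * B₃) + 2 * (B₃ * h * B₄) + 2 * (B₄ * h * B₃) - 2 * (B₂ * h * B₃) - 2 * (B₂ * h * B₄) - 2 * (B₃ * h * B₂) - 2 * (B₄ * h * B₂))] ?_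
  simp only [csum_cons, csum_nil, br]
  noncomm_ring

set_option maxHeartbeats 2000000 in
/-- **Entry `(b_1, x_4)`** of the order-`B²` Ward identity (`h` on `b₁ : x₁ → x₂` only, `λ = l` at the corner `x_4` only; the bond does not touch `x_4`): Hessian side `F_{2,2}`, `F_{2,1}`, `F_{2,0}`; current side `0`.  Collected difference 32 monomials, certificate 16. [folklore] -/
theorem ward22_b1_x4 (hτ : ∀ a b : 𝔸, τ (a * b) = τ (b * a)) :
    (4 : 𝕜) • τ (P22 𝕜 (plaq h 0 l (-l) B₁ B₂ B₃ B₄))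
      - (4 : 𝕜) • τ (P22 𝕜 (plaq h 0 0 0 B₁ B₂ B₃ B₄))
      - (4 : 𝕜) • τ (P22 𝕜 (plaq 0 0 l (-l) B₁ B₂ B₃ B₄))
      + ((4 : 𝕜) • τ (P21 𝕜 (plaq h 0 0 (l * B₄ - B₄ * l) B₁ B₂ B₃ B₄))
          - (4 : 𝕜) • τ (P21 𝕜 (plaq h 0 0 0 B₁ B₂ B₃ B₄))
          - (4 : 𝕜) • τ (P21 𝕜 (plaq 0 0 0 (l * B₄ - B₄ * l) B₁ B₂ B₃ B₄)))
      + ((2 : 𝕜) • τ (quad 𝕜 (wpart (plaq h 0 0 (B₄ * (l * B₄ - B₄ * l) - (l * B₄ - B₄ * l) * B₄) B₁ B₂ B₃ B₄)))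
          - (2 : 𝕜) • τ (quad 𝕜 (wpart (plaq h 0 0 0 B₁ B₂ B₃ B₄)))
          - (2 : 𝕜) • τ (quad 𝕜 (wpart (plaq 0 0 0 (B₄ * (l * B₄ - B₄ * l) - (l * B₄ - B₄ * l) * B₄) B₁ B₂ B₃ B₄)))) =
      0 := by
  simp only [four_smul_trace_P22 𝕜 τ hτ, four_smul_trace_P21 𝕜 τ hτ, two_smul_trace_quad 𝕜 τ, two_smul_twist₂_plaq,
    two_smul_qtwistAux, wpart_plaq, bpart_plaq, twist_plaq, sum_four_signed, two_smul_quad, commSum_four]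
  simp only [plaq, ctwistAux_consW, ctwistAux_consB, ctwistAux_nil, twistAux_consW, twistAux_consB, twistAux_nil, wpart_consW,
    wpart_consB, wpart_nil, List.sum_cons, List.sum_nil]
  simp only [← map_add, ← map_sub]
  refine trace_eq_zero_of_eq_csum 𝕜 τ hτ
    [(B₁,
      2 * (h * B₄ * l) + 2 * (l * B₄ * h) - 2 * (B₄ * l * h) - 2 * (h * l * B₄)),
    (B₂,
      2 * (h * B₄ * l) + 2 * (l * B₄ * h) - 2 * (B₄ * l * h) - 2 * (h * l * B₄)),
    (B₃,
      2 * (B₄ * l * h) + 2 * (h * l * B₄) - 2 * (h * B₄ * l) - 2 * (l * B₄ * h)),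
    (B₄,
      2 * (B₄ * l * h) + 2 * (h * l * B₄)),
    (h,
      2 * (B₄ * l * B₄)),
    (l,
      2 * (B₄ * h * B₄))] ?_
  simp only [csum_cons, csum_nil, br]
  noncomm_ring

set_option maxHeartbeats 2000000 in
/-- **Entry `(b_2, x_1)`** of the order-`B²` Ward identity (`h` on `b₂ : x₂ → x₃` only, `λ = l` at the corner `x_1` only; the bond does not touch `x_1`): Hessian side `F_{2,2}` only (`W₁λ = W₂λ = 0`: no bond of the word ends at `x₁`); current side `0`.  Collected difference 47 monomials, certificate 50. [folklore] -/
theorem ward22_b2_x1 (hτ : ∀ a b : 𝔸, τ (a * b) = τ (b * a)) :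
    (4 : 𝕜) • τ (P22 𝕜 (plaq l h 0 l B₁ B₂ B₃ B₄))
      - (4 : 𝕜) • τ (P22 𝕜 (plaq 0 h 0 0 B₁ B₂ B₃ B₄))
      - (4 : 𝕜) • τ (P22 𝕜 (plaq l 0 0 l B₁ B₂ B₃ B₄)) =
      0 := by
  simp only [four_smul_trace_P22 𝕜 τ hτ, two_smul_twist₂_plaq, two_smul_qtwistAux, wpart_plaq, bpart_plaq, twist_plaq,
    sum_four_signed, two_smul_quad, commSum_four]
  simp only [plaq, ctwistAux_consW, ctwistAux_consB, ctwistAux_nil, twistAux_consW, twistAux_consB, twistAux_nil, wpart_consW,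
    wpart_consB, wpart_nil, List.sum_cons, List.sum_nil]
  simp only [← map_add, ← map_sub]
  refine trace_eq_zero_of_eq_csum 𝕜 τ hτ
    [(B₁,
      2 * (B₁ * h * l) + 2 * (B₃ * l * h) + 2 * (B₄ * l * h) + 2 * (h * B₂ * l) + 2 * (h * l * B₃) + 2 * (h * l * B₄) + 2 * (l * B₂ * h) + 2 * (l * h * B₁) - 2 * (B₂ * l * h) - 2 * (h * B₃ * l) - 2 * (h * B₄ * l) - 2 * (h * l * B₂) - 2 * (l * B₃ * h) - 2 * (l * B₄ * h)),
    (B₂,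
      4 * (B₃ * l * h) + 4 * (B₄ * l * h) - 2 * (B₂ * l * h) - 2 * (l * h * B₂)),
    (B₃,
      4 * (l * h * B₂) - 2 * (B₃ * l * h) - 4 * (B₄ * l * h) - 2 * (l * h * B₃)),
    (B₄,
      4 * (l * h * B₂) - 2 * (B₄ * l * h) - 4 * (l * h * B₃) - 2 * (l * h * B₄)),
    (h,
      2 * (B₁ * B₃ * l) + 2 * (B₁ * B₄ * l) + 2 * (B₁ * l * B₁) + 2 * (B₁ * l * B₂) + 4 * (B₂ * B₃ * l) + 4 * (B₂ * B₄ * l) + 2 * (B₂ * l * B₁) + 2 * (l * B₃ * B₁) + 2 * (l * B₄ * B₁) - 2 * (B₁ * B₂ * l) - 2 * (B₁ * l * B₃) - 2 * (B₁ * l * B₄) - 2 * (B₂ * B₂ * l) - 2 * (B₃ * B₃ * l) - 4 * (B₃ * B₄ * l) - 2 * (B₃ * l * B₁) - 2 * (B₄ * B₄ * l) - 2 * (B₄ * l * B₁) - 2 * (l * B₂ * B₁)),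
    (l,
      2 * (B₁ * B₁ * h) + 2 * (B₁ * h * B₁) + 4 * (B₁ * h * B₂) - 4 * (B₁ * h * B₃) - 4 * (B₁ * h * B₄))] ?_
  simp only [csum_cons, csum_nil, br]
  noncomm_ring

set_option maxHeartbeats 2000000 in
/-- **Entry `(b_2, x_2)`** of the order-`B²` Ward identity (`h` on `b₂ : x₂ → x₃` only, `λ = l` at the corner `x_2` only; `x_2 = b₋`): Hessian side `F_{2,2}`, `F_{2,1}`, `F_{2,0}`; current side `2·F_{1,2}(N₀)`.  Collected difference 34 monomials, certificate 30. [folklore] -/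
theorem ward22_b2_x2 (hτ : ∀ a b : 𝔸, τ (a * b) = τ (b * a)) :
    (4 : 𝕜) • τ (P22 𝕜 (plaq (-l) (h + l) 0 0 B₁ B₂ B₃ B₄))
      - (4 : 𝕜) • τ (P22 𝕜 (plaq 0 h 0 0 B₁ B₂ B₃ B₄))
      - (4 : 𝕜) • τ (P22 𝕜 (plaq (-l) l 0 0 B₁ B₂ B₃ B₄))
      + ((4 : 𝕜) • τ (P21 𝕜 (plaq (l * B₁ - B₁ * l) h 0 0 B₁ B₂ B₃ B₄))
          - (4 : 𝕜) • τ (P21 𝕜 (plaq 0 h 0 0 B₁ B₂ B₃ B₄))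
          - (4 : 𝕜) • τ (P21 𝕜 (plaq (l * B₁ - B₁ * l) 0 0 0 B₁ B₂ B₃ B₄)))
      + ((2 : 𝕜) • τ (quad 𝕜 (wpart (plaq (B₁ * (l * B₁ - B₁ * l) - (l * B₁ - B₁ * l) * B₁) h 0 0 B₁ B₂ B₃ B₄)))
          - (2 : 𝕜) • τ (quad 𝕜 (wpart (plaq 0 h 0 0 B₁ B₂ B₃ B₄)))
          - (2 : 𝕜) • τ (quad 𝕜 (wpart (plaq (B₁ * (l * B₁ - B₁ * l) - (l * B₁ - B₁ * l) * B₁) 0 0 0 B₁ B₂ B₃ B₄)))) =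
      (2 : 𝕜) • τ (P12 𝕜 (plaq 0 (h * l - l * h) 0 0 B₁ B₂ B₃ B₄)) := by
  simp only [four_smul_trace_P22 𝕜 τ hτ, four_smul_trace_P21 𝕜 τ hτ, two_smul_trace_quad 𝕜 τ, two_smul_trace_P12 𝕜 τ,
    two_smul_twist₂_plaq, two_smul_qtwistAux, wpart_plaq, bpart_plaq, twist_plaq, sum_four_signed, two_smul_quad,
    commSum_four]
  simp only [plaq, ctwistAux_consW, ctwistAux_consB, ctwistAux_nil, twistAux_consW, twistAux_consB, twistAux_nil, wpart_consW,
    wpart_consB, wpart_nil, List.sum_cons, List.sum_nil]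
  simp only [← map_add, ← map_sub]
  refine trace_eq_of_sub_eq_csum 𝕜 τ hτ
    [(B₁,
      2 * (h * B₃ * l) + 2 * (h * B₄ * l) + 2 * (l * B₃ * h) + 2 * (l * B₄ * h) - B₁ * h * l - 3 * (B₁ * l * h) - 2 * (h * B₂ * l) - 3 * (h * l * B₁) - 2 * (l * B₂ * h) - l * h * B₁),
    (B₂,
      -(2 * (B₁ * l * h)) - 2 * (h * l * B₁)),
    (B₃,
      2 * (B₁ * l * h) + 2 * (h * l * B₁)),
    (B₄,
      2 * (B₁ * l * h) + 2 * (h * l * B₁)),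
    (h,
      2 * (B₁ * l * B₃) + 2 * (B₁ * l * B₄) + 2 * (B₃ * l * B₁) + 2 * (B₄ * l * B₁) - 4 * (B₁ * l * B₁) - 2 * (B₁ * l * B₂) - 2 * (B₂ * l * B₁)),
    (l,
      2 * (B₁ * h * B₃) + 2 * (B₁ * h * B₄) + 2 * (B₃ * h * B₁) + 2 * (B₄ * h * B₁) - 4 * (B₁ * h * B₁) - 2 * (B₁ * h * B₂) - 2 * (B₂ * h * B₁))] ?_
  simp only [csum_cons, csum_nil, br]
  noncomm_ring

set_option maxHeartbeats 2000000 in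
/-- **Entry `(b_2, x_3)`** of the order-`B²` Ward identity (`h` on `b₂ : x₂ → x₃` only, `λ = l` at the corner `x_3` only; `x_3 = b₊`): Hessian side `F_{2,2}`, `F_{2,1}`, `F_{2,0}`; current side `2·F_{1,2}(N₀)` + `2·F_{1,1}(N₁)`.  Collected difference 52 monomials, certificate 33. [folklore] -/
theorem ward22_b2_x3 (hτ : ∀ a b : 𝔸, τ (a * b) = τ (b * a)) :
    (4 : 𝕜) • τ (P22 𝕜 (plaq 0 (h - l) (-l) 0 B₁ B₂ B₃ B₄))
      - (4 : 𝕜) • τ (P22 𝕜 (plaq 0 h 0 0 B₁ B₂ B₃ B₄))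
      - (4 : 𝕜) • τ (P22 𝕜 (plaq 0 (-l) (-l) 0 B₁ B₂ B₃ B₄))
      + ((4 : 𝕜) • τ (P21 𝕜 (plaq 0 (h + (l * B₂ - B₂ * l)) (l * B₃ - B₃ * l) 0 B₁ B₂ B₃ B₄))
          - (4 : 𝕜) • τ (P21 𝕜 (plaq 0 h 0 0 B₁ B₂ B₃ B₄))
          - (4 : 𝕜) • τ (P21 𝕜 (plaq 0 (l * B₂ - B₂ * l) (l * B₃ - B₃ * l) 0 B₁ B₂ B₃ B₄)))
      + ((2 : 𝕜) • τ (quad 𝕜 (wpart (plaq 0 (h + (B₂ * (l * B₂ - B₂ * l) - (l * B₂ - B₂ * l) * B₂)) (B₃ * (l * B₃ - B₃ * l) - (l * B₃ - B₃ * l) * B₃) 0 B₁ B₂ B₃ B₄)))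
          - (2 : 𝕜) • τ (quad 𝕜 (wpart (plaq 0 h 0 0 B₁ B₂ B₃ B₄)))
          - (2 : 𝕜) • τ (quad 𝕜 (wpart (plaq 0 (B₂ * (l * B₂ - B₂ * l) - (l * B₂ - B₂ * l) * B₂) (B₃ * (l * B₃ - B₃ * l) - (l * B₃ - B₃ * l) * B₃) 0 B₁ B₂ B₃ B₄)))) =
      (2 : 𝕜) • τ (P12 𝕜 (plaq 0 (h * l - l * h) 0 0 B₁ B₂ B₃ B₄)) + (2 : 𝕜) • τ (P11 (plaq 0 ((l * B₂ - B₂ * l) * h - h * (l * B₂ - B₂ * l)) 0 0 B₁ B₂ B₃ B₄)) := by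
  simp only [four_smul_trace_P22 𝕜 τ hτ, four_smul_trace_P21 𝕜 τ hτ, two_smul_trace_quad 𝕜 τ, two_smul_trace_P12 𝕜 τ,
    two_smul_trace_P11 𝕜 τ, two_smul_twist₂_plaq, two_smul_qtwistAux, wpart_plaq, bpart_plaq, twist_plaq, sum_four_signed,
    two_smul_quad, commSum_four]
  simp only [plaq, ctwistAux_consW, ctwistAux_consB, ctwistAux_nil, twistAux_consW, twistAux_consB, twistAux_nil, wpart_consW,
    wpart_consB, wpart_nil, List.sum_cons, List.sum_nil]
  simp only [← map_add, ← map_sub]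
  refine trace_eq_of_sub_eq_csum 𝕜 τ hτ
    [(B₁,
      B₁ * l * h + h * l * B₁ - B₁ * h * l - l * h * B₁),
    (B₂,
      2 * (h * B₃ * l) + 2 * (l * B₃ * h) - B₂ * h * l - 2 * (B₃ * l * h) - h * l * B₂ - 2 * (h * l * B₃)),
    (B₃,
      2 * (B₃ * l * h) + 2 * (h * B₄ * l) + 2 * (h * l * B₃) + 2 * (l * B₄ * h)),
    (B₄,
      2 * (B₃ * l * h) + 2 * (h * l * B₃)),
    (h,
      2 * (B₁ * B₃ * l) + 2 * (B₁ * l * B₂) + B₂ * B₂ * l + 2 * (B₂ * l * B₁) + 2 * (B₃ * l * B₃) + 2 * (B₃ * l * B₄) + 2 * (B₄ * l * B₃) + 2 * (l * B₃ * B₁) - 2 * (B₁ * B₂ * l) - 2 * (B₁ * l * B₃) - 2 * (B₂ * l * B₂) - 2 * (B₃ * l * B₁) - 2 * (l * B₂ * B₁)),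
    (l,
      2 * (B₃ * h * B₃) + 2 * (B₃ * h * B₄) + 2 * (B₄ * h * B₃) - B₂ * B₂ * h)] ?_
  simp only [csum_cons, csum_nil, br]
  noncomm_ring

set_option maxHeartbeats 2000000 in
/-- **Entry `(b_2, x_4)`** of the order-`B²` Ward identity (`h` on `b₂ : x₂ → x₃` only, `λ = l` at the corner `x_4` only; the bond does not touch `x_4`): Hessian side `F_{2,2}`, `F_{2,1}`, `F_{2,0}`; current side `0`.  Collected difference 32 monomials, certificate 16. [folklore] -/
theorem ward22_b2_x4 (hτ : ∀ a b : 𝔸, τ (a * b) = τ (b * a)) :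
    (4 : 𝕜) • τ (P22 𝕜 (plaq 0 h l (-l) B₁ B₂ B₃ B₄))
      - (4 : 𝕜) • τ (P22 𝕜 (plaq 0 h 0 0 B₁ B₂ B₃ B₄))
      - (4 : 𝕜) • τ (P22 𝕜 (plaq 0 0 l (-l) B₁ B₂ B₃ B₄))
      + ((4 : 𝕜) • τ (P21 𝕜 (plaq 0 h 0 (l * B₄ - B₄ * l) B₁ B₂ B₃ B₄))
          - (4 : 𝕜) • τ (P21 𝕜 (plaq 0 h 0 0 B₁ B₂ B₃ B₄))
          - (4 : 𝕜) • τ (P21 𝕜 (plaq 0 0 0 (l * B₄ - B₄ * l) B₁ B₂ B₃ B₄)))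
      + ((2 : 𝕜) • τ (quad 𝕜 (wpart (plaq 0 h 0 (B₄ * (l * B₄ - B₄ * l) - (l * B₄ - B₄ * l) * B₄) B₁ B₂ B₃ B₄)))
          - (2 : 𝕜) • τ (quad 𝕜 (wpart (plaq 0 h 0 0 B₁ B₂ B₃ B₄)))
          - (2 : 𝕜) • τ (quad 𝕜 (wpart (plaq 0 0 0 (B₄ * (l * B₄ - B₄ * l) - (l * B₄ - B₄ * l) * B₄) B₁ B₂ B₃ B₄)))) =
      0 := by
  simp only [four_smul_trace_P22 𝕜 τ hτ, four_smul_trace_P21 𝕜 τ hτ, two_smul_trace_quad 𝕜 τ, two_smul_twist₂_plaq,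
    two_smul_qtwistAux, wpart_plaq, bpart_plaq, twist_plaq, sum_four_signed, two_smul_quad, commSum_four]
  simp only [plaq, ctwistAux_consW, ctwistAux_consB, ctwistAux_nil, twistAux_consW, twistAux_consB, twistAux_nil, wpart_consW,
    wpart_consB, wpart_nil, List.sum_cons, List.sum_nil]
  simp only [← map_add, ← map_sub]
  refine trace_eq_zero_of_eq_csum 𝕜 τ hτ
    [(B₂,
      2 * (h * B₄ * l) + 2 * (l * B₄ * h) - 2 * (B₄ * l * h) - 2 * (h * l * B₄)),
    (B₃,
      2 * (B₄ * l * h) + 2 * (h * l * B₄) - 2 * (h * B₄ * l) - 2 * (l * B₄ * h)),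
    (B₄,
      2 * (B₄ * l * h) + 2 * (h * l * B₄)),
    (h,
      2 * (B₁ * B₄ * l) + 2 * (B₄ * l * B₄) + 2 * (l * B₄ * B₁) - 2 * (B₁ * l * B₄) - 2 * (B₄ * l * B₁)),
    (l,
      2 * (B₄ * h * B₄))] ?_
  simp only [csum_cons, csum_nil, br]
  noncomm_ring

set_option maxHeartbeats 2000000 in
/-- **Entry `(b_3, x_1)`** of the order-`B²` Ward identity (`h` on `b₃ : x₄ → x₃` only, `λ = l` at the corner `x_1` only; the bond does not touch `x_1`): Hessian side `F_{2,2}` only (`W₁λ = W₂λ = 0`: no bond of the word ends at `x₁`); current side `0`.  Collected difference 104 monomials, certificate 81. [folklore] -/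
theorem ward22_b3_x1 (hτ : ∀ a b : 𝔸, τ (a * b) = τ (b * a)) :
    (4 : 𝕜) • τ (P22 𝕜 (plaq l 0 h l B₁ B₂ B₃ B₄))
      - (4 : 𝕜) • τ (P22 𝕜 (plaq 0 0 h 0 B₁ B₂ B₃ B₄))
      - (4 : 𝕜) • τ (P22 𝕜 (plaq l 0 0 l B₁ B₂ B₃ B₄)) =
      0 := by
  simp only [four_smul_trace_P22 𝕜 τ hτ, two_smul_twist₂_plaq, two_smul_qtwistAux, wpart_plaq, bpart_plaq, twist_plaq,
    sum_four_signed, two_smul_quad, commSum_four]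
  simp only [plaq, ctwistAux_consW, ctwistAux_consB, ctwistAux_nil, twistAux_consW, twistAux_consB, twistAux_nil, wpart_consW,
    wpart_consB, wpart_nil, List.sum_cons, List.sum_nil]
  simp only [← map_add, ← map_sub]
  refine trace_eq_zero_of_eq_csum 𝕜 τ hτ
    [(B₁,
      2 * (B₂ * l * h) + 2 * (B₃ * h * l) + 2 * (h * B₄ * l) + 2 * (h * l * B₂) + 2 * (l * B₄ * h) + 2 * (l * h * B₃) - 2 * (B₁ * h * l) - 2 * (B₂ * h * l) - 2 * (B₃ * l * h) - 2 * (B₄ * l * h) - 2 * (h * l * B₃) - 2 * (h * l * B₄) - 2 * (l * h * B₁) - 2 * (l * h * B₂)),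
    (B₂,
      2 * (B₃ * h * l) + 2 * (h * B₄ * l) + 2 * (l * B₄ * h) + 2 * (l * h * B₃) - 2 * (B₂ * h * l) - 2 * (B₃ * l * h) - 2 * (B₄ * l * h) - 2 * (h * l * B₃) - 2 * (h * l * B₄) - 2 * (l * h * B₂)),
    (B₃,
      2 * (B₄ * l * h) + 2 * (h * l * B₄) - 2 * (B₃ * h * l) - 2 * (h * B₄ * l) - 2 * (l * B₄ * h) - 2 * (l * h * B₃)),
    (B₄,
      2 * (B₄ * l * h) + 2 * (l * h * B₄)),
    (h,
      2 * (B₁ * B₂ * l) + 2 * (B₁ * l * B₃) + 2 * (B₁ * l * B₄) + 2 * (B₂ * l * B₃) + 2 * (B₂ * l * B₄) + 2 * (B₃ * B₄ * l) + 2 * (B₃ * l * B₁) + 2 * (B₃ * l * B₂) + 2 * (B₄ * B₄ * l) + 2 * (B₄ * l * B₁) + 2 * (B₄ * l * B₂) + 2 * (l * B₂ * B₁) + 2 * (l * B₄ * B₃) - 2 * (B₁ * B₃ * l) - 2 * (B₁ * B₄ * l) - 2 * (B₁ * l * B₁) - 2 * (B₁ * l * B₂) - 2 * (B₂ * B₃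 * l) - 2 * (B₂ * B₄ * l) - 2 * (B₂ * l * B₁) - 2 * (B₂ * l * B₂) - 2 * (B₃ * l * B₃) - 2 * (B₃ * l * B₄) - 2 * (B₄ * l * B₃) - 2 * (l * B₃ * B₁) - 2 * (l * B₃ * B₂) - 2 * (l * B₄ * B₁) - 2 * (l * B₄ * B₂)),
    (l,
      2 * (B₁ * B₃ * h) + 2 * (B₁ * h * B₃) + 4 * (B₁ * h * B₄) + 2 * (B₂ * B₃ * h) + 2 * (B₂ * h * B₃) + 4 * (B₂ * h * B₄) + 2 * (B₃ * h * B₁) + 2 * (B₃ * h * B₂) + 2 * (h * B₂ * B₁) - 2 * (B₁ * B₁ * h) - 2 * (B₁ * B₂ * h) - 2 * (B₁ * h * B₁) - 2 * (B₁ * h * B₂) - 2 * (B₂ * B₂ * h) - 2 * (B₂ * h * B₁) - 2 * (B₂ * h * B₂) - 2 * (B₃ * B₃ * h) - 2 * (B₃ * h * B₃) - 4 * (B₃ * h * B₄) - 2 * (h * B₃ * B₁) - 2 * (h * B₃ * B₂))] ?_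
  simp only [csum_cons, csum_nil, br]
  noncomm_ring

set_option maxHeartbeats 2000000 in
/-- **Entry `(b_3, x_2)`** of the order-`B²` Ward identity (`h` on `b₃ : x₄ → x₃` only, `λ = l` at the corner `x_2` only; the bond does not touch `x_2`): Hessian side `F_{2,2}`, `F_{2,1}`, `F_{2,0}`; current side `0`.  Collected difference 40 monomials, certificate 36. [folklore] -/
theorem ward22_b3_x2 (hτ : ∀ a b : 𝔸, τ (a * b) = τ (b * a)) :
    (4 : 𝕜) • τ (P22 𝕜 (plaq (-l) l h 0 B₁ B₂ B₃ B₄))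
      - (4 : 𝕜) • τ (P22 𝕜 (plaq 0 0 h 0 B₁ B₂ B₃ B₄))
      - (4 : 𝕜) • τ (P22 𝕜 (plaq (-l) l 0 0 B₁ B₂ B₃ B₄))
      + ((4 : 𝕜) • τ (P21 𝕜 (plaq (l * B₁ - B₁ * l) 0 h 0 B₁ B₂ B₃ B₄))
          - (4 : 𝕜) • τ (P21 𝕜 (plaq 0 0 h 0 B₁ B₂ B₃ B₄))
          - (4 : 𝕜) • τ (P21 𝕜 (plaq (l * B₁ - B₁ * l) 0 0 0 B₁ B₂ B₃ B₄)))
      + ((2 : 𝕜) • τ (quad 𝕜 (wpart (plaq (B₁ * (l * B₁ - B₁ * l) - (l * B₁ - B₁ * l) * B₁) 0 h 0 B₁ B₂ B₃ B₄)))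
          - (2 : 𝕜) • τ (quad 𝕜 (wpart (plaq 0 0 h 0 B₁ B₂ B₃ B₄)))
          - (2 : 𝕜) • τ (quad 𝕜 (wpart (plaq (B₁ * (l * B₁ - B₁ * l) - (l * B₁ - B₁ * l) * B₁) 0 0 0 B₁ B₂ B₃ B₄)))) =
      0 := by
  simp only [four_smul_trace_P22 𝕜 τ hτ, four_smul_trace_P21 𝕜 τ hτ, two_smul_trace_quad 𝕜 τ, two_smul_twist₂_plaq,
    two_smul_qtwistAux, wpart_plaq, bpart_plaq, twist_plaq, sum_four_signed, two_smul_quad, commSum_four]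
  simp only [plaq, ctwistAux_consW, ctwistAux_consB, ctwistAux_nil, twistAux_consW, twistAux_consB, twistAux_nil, wpart_consW,
    wpart_consB, wpart_nil, List.sum_cons, List.sum_nil]
  simp only [← map_add, ← map_sub]
  refine trace_eq_zero_of_eq_csum 𝕜 τ hτ
    [(B₁,
      4 * (B₁ * l * h) + 2 * (B₃ * h * l) + 4 * (h * B₂ * l) + 4 * (h * l * B₁) + 4 * (l * B₂ * h) + 2 * (l * h * B₃) - 2 * (B₂ * h * l) - 4 * (h * B₃ * l) - 2 * (h * B₄ * l) - 4 * (l * B₃ * h) - 2 * (l * B₄ * h) - 2 * (l * h * B₂)),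
    (B₂,
      2 * (B₁ * l * h) + 2 * (h * l * B₁)),
    (B₃,
      -(2 * (B₁ * l * h)) - 2 * (h * l * B₁)),
    (B₄,
      -(2 * (B₁ * l * h)) - 2 * (h * l * B₁)),
    (h,
      4 * (B₁ * l * B₁) + 2 * (B₁ * l * B₂) + 2 * (B₂ * l * B₁) - 2 * (B₁ * l * B₃) - 2 * (B₁ * l * B₄) - 2 * (B₃ * l * B₁) - 2 * (B₄ * l * B₁)),
    (l,
      2 * (B₁ * B₃ * h) + 4 * (B₁ * h * B₁) + 4 * (B₁ * h * B₂) + 4 * (B₂ * h * B₁) + 2 * (h * B₃ * B₁) - 2 * (B₁ * B₂ * h) - 4 * (B₁ * h * B₃) - 2 * (B₁ * h * B₄) - 4 * (B₃ * h * B₁) - 2 * (B₄ * h * B₁) - 2 * (h * B₂ * B₁))] ?_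
  simp only [csum_cons, csum_nil, br]
  noncomm_ring

set_option maxHeartbeats 2000000 in
/-- **Entry `(b_3, x_3)`** of the order-`B²` Ward identity (`h` on `b₃ : x₄ → x₃` only, `λ = l` at the corner `x_3` only; `x_3 = b₊`): Hessian side `F_{2,2}`, `F_{2,1}`, `F_{2,0}`; current side `2·F_{1,2}(N₀)` + `2·F_{1,1}(N₁)`.  Collected difference 78 monomials, certificate 55. [folklore] -/
theorem ward22_b3_x3 (hτ : ∀ a b : 𝔸, τ (a * b) = τ (b * a)) :
    (4 : 𝕜) • τ (P22 𝕜 (plaq 0 (-l) (h - l) 0 B₁ B₂ B₃ B₄))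
      - (4 : 𝕜) • τ (P22 𝕜 (plaq 0 0 h 0 B₁ B₂ B₃ B₄))
      - (4 : 𝕜) • τ (P22 𝕜 (plaq 0 (-l) (-l) 0 B₁ B₂ B₃ B₄))
      + ((4 : 𝕜) • τ (P21 𝕜 (plaq 0 (l * B₂ - B₂ * l) (h + (l * B₃ - B₃ * l)) 0 B₁ B₂ B₃ B₄))
          - (4 : 𝕜) • τ (P21 𝕜 (plaq 0 0 h 0 B₁ B₂ B₃ B₄))
          - (4 : 𝕜) • τ (P21 𝕜 (plaq 0 (l * B₂ - B₂ * l) (l * B₃ - B₃ * l) 0 B₁ B₂ B₃ B₄)))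
      + ((2 : 𝕜) • τ (quad 𝕜 (wpart (plaq 0 (B₂ * (l * B₂ - B₂ * l) - (l * B₂ - B₂ * l) * B₂) (h + (B₃ * (l * B₃ - B₃ * l) - (l * B₃ - B₃ * l) * B₃)) 0 B₁ B₂ B₃ B₄)))
          - (2 : 𝕜) • τ (quad 𝕜 (wpart (plaq 0 0 h 0 B₁ B₂ B₃ B₄)))
          - (2 : 𝕜) • τ (quad 𝕜 (wpart (plaq 0 (B₂ * (l * B₂ - B₂ * l) - (l * B₂ - B₂ * l) * B₂) (B₃ * (l * B₃ - B₃ * l) - (l * B₃ - B₃ * l) * B₃) 0 B₁ B₂ B₃ B₄)))) =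
      (2 : 𝕜) • τ (P12 𝕜 (plaq 0 0 (h * l - l * h) 0 B₁ B₂ B₃ B₄)) + (2 : 𝕜) • τ (P11 (plaq 0 0 ((l * B₃ - B₃ * l) * h - h * (l * B₃ - B₃ * l)) 0 B₁ B₂ B₃ B₄)) := by
  simp only [four_smul_trace_P22 𝕜 τ hτ, four_smul_trace_P21 𝕜 τ hτ, two_smul_trace_quad 𝕜 τ, two_smul_trace_P12 𝕜 τ,
    two_smul_trace_P11 𝕜 τ, two_smul_twist₂_plaq, two_smul_qtwistAux, wpart_plaq, bpart_plaq, twist_plaq, sum_four_signed,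
    two_smul_quad, commSum_four]
  simp only [plaq, ctwistAux_consW, ctwistAux_consB, ctwistAux_nil, twistAux_consW, twistAux_consB, twistAux_nil, wpart_consW,
    wpart_consB, wpart_nil, List.sum_cons, List.sum_nil]
  simp only [← map_add, ← map_sub]
  refine trace_eq_of_sub_eq_csum 𝕜 τ hτ
    [(B₁,
      B₁ * h * l + 2 * (B₂ * h * l) + 2 * (B₂ * l * h) + 4 * (h * B₃ * l) + 2 * (h * l * B₂) + 4 * (l * B₃ * h) + l * h * B₁ + 2 * (l * h * B₂) - B₁ * l * h - 2 * (B₃ * h * l) - 2 * (B₃ * l * h) - 4 * (h * B₂ * l) - h * l * B₁ - 2 * (h * l * B₃) - 4 * (l * B₂ * h) - 2 * (l * h * B₃)),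
    (B₂,
      B₂ * h * l + 3 * (B₂ * l * h) + 3 * (h * l * B₂) + l * h * B₂ - 2 * (B₃ * l * h) - 2 * (h * B₄ * l) - 2 * (h * l * B₃) - 2 * (l * B₄ * h)),
    (B₃,
      3 * (B₃ * l * h) + l * h * B₃ - 2 * (B₂ * l * h) - 2 * (B₃ * h * l) - 2 * (h * l * B₂)),
    (B₄,
      -(2 * (B₂ * l * h)) - 2 * (h * l * B₂)),
    (h,
      2 * (B₁ * B₂ * l) + 2 * (B₁ * l * B₃) + 4 * (B₂ * l * B₂) + 3 * (B₃ * B₃ * l) + 2 * (B₃ * l * B₁) + 2 * (l * B₂ * B₁) - 2 * (B₁ * B₃ * l) - 2 * (B₁ * l * B₂) - 2 * (B₂ * B₃ * l) - 2 * (B₂ * l * B₁) - 2 * (B₂ * l * B₄) - 2 * (B₃ * l * B₃) - 2 * (B₄ * l * B₂) - 2 * (l * B₃ * B₁) - 2 * (l * B₃ * B₂)),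
    (l,
      2 * (B₂ * B₃ * h) + 4 * (B₂ * h * B₂) + 4 * (B₃ * h * B₃) + 2 * (h * B₃ * B₂) - 4 * (B₂ * h * B₃) - 2 * (B₂ * h * B₄) - 3 * (B₃ * B₃ * h) - 4 * (B₃ * h * B₂) - 2 * (B₄ * h * B₂))] ?_
  simp only [csum_cons, csum_nil, br]
  noncomm_ring

set_option maxHeartbeats 2000000 in
/-- **Entry `(b_3, x_4)`** of the order-`B²` Ward identity (`h` on `b₃ : x₄ → x₃` only, `λ = l` at the corner `x_4` only; `x_4 = b₋`): Hessian side `F_{2,2}`, `F_{2,1}`, `F_{2,0}`; current side `2·F_{1,2}(N₀)`.  Collected difference 74 monomials, certificate 40. [folklore] -/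
theorem ward22_b3_x4 (hτ : ∀ a b : 𝔸, τ (a * b) = τ (b * a)) :
    (4 : 𝕜) • τ (P22 𝕜 (plaq 0 0 (h + l) (-l) B₁ B₂ B₃ B₄))
      - (4 : 𝕜) • τ (P22 𝕜 (plaq 0 0 h 0 B₁ B₂ B₃ B₄))
      - (4 : 𝕜) • τ (P22 𝕜 (plaq 0 0 l (-l) B₁ B₂ B₃ B₄))
      + ((4 : 𝕜) • τ (P21 𝕜 (plaq 0 0 h (l * B₄ - B₄ * l) B₁ B₂ B₃ B₄))
          - (4 : 𝕜) • τ (P21 𝕜 (plaq 0 0 h 0 B₁ B₂ B₃ B₄))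
          - (4 : 𝕜) • τ (P21 𝕜 (plaq 0 0 0 (l * B₄ - B₄ * l) B₁ B₂ B₃ B₄)))
      + ((2 : 𝕜) • τ (quad 𝕜 (wpart (plaq 0 0 h (B₄ * (l * B₄ - B₄ * l) - (l * B₄ - B₄ * l) * B₄) B₁ B₂ B₃ B₄)))
          - (2 : 𝕜) • τ (quad 𝕜 (wpart (plaq 0 0 h 0 B₁ B₂ B₃ B₄)))
          - (2 : 𝕜) • τ (quad 𝕜 (wpart (plaq 0 0 0 (B₄ * (l * B₄ - B₄ * l) - (l * B₄ - B₄ * l) * B₄) B₁ B₂ B₃ B₄)))) =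
      (2 : 𝕜) • τ (P12 𝕜 (plaq 0 0 (h * l - l * h) 0 B₁ B₂ B₃ B₄)) := by
  simp only [four_smul_trace_P22 𝕜 τ hτ, four_smul_trace_P21 𝕜 τ hτ, two_smul_trace_quad 𝕜 τ, two_smul_trace_P12 𝕜 τ,
    two_smul_twist₂_plaq, two_smul_qtwistAux, wpart_plaq, bpart_plaq, twist_plaq, sum_four_signed, two_smul_quad,
    commSum_four]
  simp only [plaq, ctwistAux_consW, ctwistAux_consB, ctwistAux_nil, twistAux_consW, twistAux_consB, twistAux_nil, wpart_consW,
    wpart_consB, wpart_nil, List.sum_cons, List.sum_nil]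
  simp only [← map_add, ← map_sub]
  refine trace_eq_of_sub_eq_csum 𝕜 τ hτ
    [(B₁,
      B₁ * h * l + 2 * (B₂ * h * l) + 2 * (B₃ * l * h) + 2 * (h * l * B₃) + l * h * B₁ + 2 * (l * h * B₂) - B₁ * l * h - 2 * (B₂ * l * h) - 2 * (B₃ * h * l) - h * l * B₁ - 2 * (h * l * B₂) - 2 * (l * h * B₃)),
    (B₂,
      B₂ * h * l + 2 * (B₃ * l * h) + 2 * (h * l * B₃) + l * h * B₂ - B₂ * l * h - 2 * (B₃ * h * l) - h * l * B₂ - 2 * (l * h * B₃)),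
    (B₃,
      B₃ * h * l + l * h * B₃ - B₃ * l * h - h * l * B₃),
    (B₄,
      -(2 * (B₄ * l * h)) - 2 * (h * l * B₄)),
    (h,
      2 * (B₁ * l * B₄) + 2 * (B₂ * l * B₄) + 2 * (B₃ * B₄ * l) + 2 * (B₄ * l * B₁) + 2 * (B₄ * l * B₂) + 2 * (l * B₄ * B₃) - 2 * (B₁ * B₄ * l) - 2 * (B₂ * B₄ * l) - 2 * (B₃ * l * B₄) - 2 * (B₄ * l * B₃) - 2 * (B₄ * l * B₄) - 2 * (l * B₄ * B₁) - 2 * (l * B₄ * B₂)),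
    (l,
      -(2 * (B₄ * h * B₄)))] ?_
  simp only [csum_cons, csum_nil, br]
  noncomm_ring

set_option maxHeartbeats 2000000 in
/-- **Entry `(b_4, x_1)`** of the order-`B²` Ward identity (`h` on `b₄ : x₁ → x₄` only, `λ = l` at the corner `x_1` only; `x_1 = b₋`): Hessian side `F_{2,2}` only (`W₁λ = W₂λ = 0`: no bond of the word ends at `x₁`); current side `2·F_{1,2}(N₀)`.  Collected difference 132 monomials, certificate 76. [folklore] -/
theorem ward22_b4_x1 (hτ : ∀ a b : 𝔸, τ (a * b) = τ (b * a)) :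
    (4 : 𝕜) • τ (P22 𝕜 (plaq l 0 0 (h + l) B₁ B₂ B₃ B₄))
      - (4 : 𝕜) • τ (P22 𝕜 (plaq 0 0 0 h B₁ B₂ B₃ B₄))
      - (4 : 𝕜) • τ (P22 𝕜 (plaq l 0 0 l B₁ B₂ B₃ B₄)) =
      (2 : 𝕜) • τ (P12 𝕜 (plaq 0 0 0 (h * l - l * h) B₁ B₂ B₃ B₄)) := by
  simp only [four_smul_trace_P22 𝕜 τ hτ, two_smul_trace_P12 𝕜 τ, two_smul_twist₂_plaq, two_smul_qtwistAux, wpart_plaq, bpart_plaq,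
    twist_plaq, sum_four_signed, two_smul_quad, commSum_four]
  simp only [plaq, ctwistAux_consW, ctwistAux_consB, ctwistAux_nil, twistAux_consW, twistAux_consB, twistAux_nil, wpart_consW,
    wpart_consB, wpart_nil, List.sum_cons, List.sum_nil]
  simp only [← map_add, ← map_sub]
  refine trace_eq_of_sub_eq_csum 𝕜 τ hτ
    [(B₁,
      -(B₁ * h * l) - B₁ * l * h - h * l * B₁ - l * h * B₁),
    (B₂,
      -(B₂ * h * l) - B₂ * l * h - h * l * B₂ - l * h * B₂),
    (B₃,
      -(B₃ * h * l) - B₃ * l * h - h * l * B₃ - l * h * B₃),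
    (B₄,
      -(B₄ * h * l) - B₄ * l * h - h * l * B₄ - l * h * B₄),
    (h,
      2 * (B₁ * B₂ * l) + 2 * (B₁ * l * B₃) + 2 * (B₁ * l * B₄) + 2 * (B₂ * l * B₃) + 2 * (B₂ * l * B₄) + 2 * (B₃ * B₄ * l) + 2 * (B₃ * l * B₁) + 2 * (B₃ * l * B₂) + 2 * (B₄ * l * B₁) + 2 * (B₄ * l * B₂) + 2 * (l * B₂ * B₁) + 2 * (l * B₄ * B₃) - 2 * (B₁ * B₃ * l) - 2 * (B₁ * B₄ * l) - 2 * (B₁ * l * B₁) - 2 * (B₁ * l * B₂) - 2 * (B₂ * B₃ * l) - 2 * (B₂ * B₄ * l) - 2 * (B₂ * l * B₁) - 2 * (B₂ * l * B₂) - 2 * (B₃ * l * B₃) - 2 * (B₃ * l * B₄) - 2 * (B₄ * l * B₃) - 2 * (B₄ * l * B₄) - 2 * (l * B₃ * B₁) - 2 * (l * B₃ * B₂) - 2 * (l * B₄ * B₁) - 2 * (l * B₄ * B₂)),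
    (l,
      2 * (B₁ * B₃ * h) + 2 * (B₁ * B₄ * h) + 2 * (B₁ * h * B₃) + 2 * (B₁ * h * B₄) + 2 * (B₂ * B₃ * h) + 2 * (B₂ * B₄ * h) + 2 * (B₂ * h * B₃) + 2 * (B₂ * h * B₄) + 2 * (B₃ * h * B₁) + 2 * (B₃ * h * B₂) + 2 * (B₄ * h * B₁) + 2 * (B₄ * h * B₂) + 2 * (h * B₂ * B₁) + 2 * (h * B₄ * B₃) - 2 * (B₁ * B₁ * h) - 2 * (B₁ * B₂ * h) - 2 * (B₁ * h * B₁) - 2 * (B₁ * h * B₂) - 2 * (B₂ * B₂ * h) - 2 * (B₂ * h * B₁) - 2 * (B₂ * h * B₂) - 2 * (B₃ * B₃ * h) - 2 * (B₃ * B₄ * h) - 2 * (B₃ * h * B₃) - 2 * (B₃ * h * B₄) - 2 * (B₄ * B₄ * h) - 2 * (B₄ * h * B₃) - 2 * (B₄ * h * B₄) - 2 * (h * B₃ * B₁) - 2 * (h * B₃ * B₂) - 2 * (h * B₄ * B₁) - 2 * (h * B₄ * B₂))] ?_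
  simp only [csum_cons, csum_nil, br]
  noncomm_ring

set_option maxHeartbeats 2000000 in
/-- **Entry `(b_4, x_2)`** of the order-`B²` Ward identity (`h` on `b₄ : x₁ → x₄` only, `λ = l` at the corner `x_2` only; the bond does not touch `x_2`): Hessian side `F_{2,2}`, `F_{2,1}`, `F_{2,0}`; current side `0`.  Collected difference 44 monomials, certificate 40. [folklore] -/
theorem ward22_b4_x2 (hτ : ∀ a b : 𝔸, τ (a * b) = τ (b * a)) :
    (4 : 𝕜) • τ (P22 𝕜 (plaq (-l) l 0 h B₁ B₂ B₃ B₄))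
      - (4 : 𝕜) • τ (P22 𝕜 (plaq 0 0 0 h B₁ B₂ B₃ B₄))
      - (4 : 𝕜) • τ (P22 𝕜 (plaq (-l) l 0 0 B₁ B₂ B₃ B₄))
      + ((4 : 𝕜) • τ (P21 𝕜 (plaq (l * B₁ - B₁ * l) 0 0 h B₁ B₂ B₃ B₄))
          - (4 : 𝕜) • τ (P21 𝕜 (plaq 0 0 0 h B₁ B₂ B₃ B₄))
          - (4 : 𝕜) • τ (P21 𝕜 (plaq (l * B₁ - B₁ * l) 0 0 0 B₁ B₂ B₃ B₄)))
      + ((2 : 𝕜) • τ (quad 𝕜 (wpart (plaq (B₁ * (l * B₁ - B₁ * l) - (l * B₁ - B₁ * l) * B₁) 0 0 h B₁ B₂ B₃ B₄)))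
          - (2 : 𝕜) • τ (quad 𝕜 (wpart (plaq 0 0 0 h B₁ B₂ B₃ B₄)))
          - (2 : 𝕜) • τ (quad 𝕜 (wpart (plaq (B₁ * (l * B₁ - B₁ * l) - (l * B₁ - B₁ * l) * B₁) 0 0 0 B₁ B₂ B₃ B₄)))) =
      0 := by
  simp only [four_smul_trace_P22 𝕜 τ hτ, four_smul_trace_P21 𝕜 τ hτ, two_smul_trace_quad 𝕜 τ, two_smul_twist₂_plaq,
    two_smul_qtwistAux, wpart_plaq, bpart_plaq, twist_plaq, sum_four_signed, two_smul_quad, commSum_four]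
  simp only [plaq, ctwistAux_consW, ctwistAux_consB, ctwistAux_nil, twistAux_consW, twistAux_consB, twistAux_nil, wpart_consW,
    wpart_consB, wpart_nil, List.sum_cons, List.sum_nil]
  simp only [← map_add, ← map_sub]
  refine trace_eq_zero_of_eq_csum 𝕜 τ hτ
    [(B₁,
      4 * (B₁ * l * h) + 2 * (B₃ * h * l) + 2 * (B₄ * h * l) + 4 * (h * B₂ * l) + 4 * (h * l * B₁) + 4 * (l * B₂ * h) + 2 * (l * h * B₃) + 2 * (l * h * B₄) - 2 * (B₂ * h * l) - 4 * (h * B₃ * l) - 4 * (h * B₄ * l) - 4 * (l * B₃ * h) - 4 * (l * B₄ * h) - 2 * (l * h * B₂)),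
    (B₂,
      2 * (B₁ * l * h) + 2 * (h * l * B₁)),
    (B₃,
      -(2 * (B₁ * l * h)) - 2 * (h * l * B₁)),
    (B₄,
      -(2 * (B₁ * l * h)) - 2 * (h * l * B₁)),
    (h,
      4 * (B₁ * l * B₁) + 2 * (B₁ * l * B₂) + 2 * (B₂ * l * B₁) - 2 * (B₁ * l * B₃) - 2 * (B₁ * l * B₄) - 2 * (B₃ * l * B₁) - 2 * (B₄ * l * B₁)),
    (l,
      2 * (B₁ * B₃ * h) + 2 * (B₁ * B₄ * h) + 4 * (B₁ * h * B₁) + 4 * (B₁ * h * B₂) + 4 * (B₂ * h * B₁) + 2 * (h * B₃ * B₁) + 2 * (h * B₄ * B₁) - 2 * (B₁ * B₂ * h) - 4 * (B₁ * h * B₃) - 4 * (B₁ * h * B₄) - 4 * (B₃ * h * B₁) - 4 * (B₄ * h * B₁) - 2 * (h * B₂ * B₁))] ?_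
  simp only [csum_cons, csum_nil, br]
  noncomm_ring

set_option maxHeartbeats 2000000 in
/-- **Entry `(b_4, x_3)`** of the order-`B²` Ward identity (`h` on `b₄ : x₁ → x₄` only, `λ = l` at the corner `x_3` only; the bond does not touch `x_3`): Hessian side `F_{2,2}`, `F_{2,1}`, `F_{2,0}`; current side `0`.  Collected difference 80 monomials, certificate 62. [folklore] -/
theorem ward22_b4_x3 (hτ : ∀ a b : 𝔸, τ (a * b) = τ (b * a)) :
    (4 : 𝕜) • τ (P22 𝕜 (plaq 0 (-l) (-l) h B₁ B₂ B₃ B₄))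
      - (4 : 𝕜) • τ (P22 𝕜 (plaq 0 0 0 h B₁ B₂ B₃ B₄))
      - (4 : 𝕜) • τ (P22 𝕜 (plaq 0 (-l) (-l) 0 B₁ B₂ B₃ B₄))
      + ((4 : 𝕜) • τ (P21 𝕜 (plaq 0 (l * B₂ - B₂ * l) (l * B₃ - B₃ * l) h B₁ B₂ B₃ B₄))
          - (4 : 𝕜) • τ (P21 𝕜 (plaq 0 0 0 h B₁ B₂ B₃ B₄))
          - (4 : 𝕜) • τ (P21 𝕜 (plaq 0 (l * B₂ - B₂ * l) (l * B₃ - B₃ * l) 0 B₁ B₂ B₃ B₄)))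
      + ((2 : 𝕜) • τ (quad 𝕜 (wpart (plaq 0 (B₂ * (l * B₂ - B₂ * l) - (l * B₂ - B₂ * l) * B₂) (B₃ * (l * B₃ - B₃ * l) - (l * B₃ - B₃ * l) * B₃) h B₁ B₂ B₃ B₄)))
          - (2 : 𝕜) • τ (quad 𝕜 (wpart (plaq 0 0 0 h B₁ B₂ B₃ B₄)))
          - (2 : 𝕜) • τ (quad 𝕜 (wpart (plaq 0 (B₂ * (l * B₂ - B₂ * l) - (l * B₂ - B₂ * l) * B₂) (B₃ * (l * B₃ - B₃ * l) - (l * B₃ - B₃ * l) * B₃) 0 B₁ B₂ B₃ B₄)))) =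
      0 := by
  simp only [four_smul_trace_P22 𝕜 τ hτ, four_smul_trace_P21 𝕜 τ hτ, two_smul_trace_quad 𝕜 τ, two_smul_twist₂_plaq,
    two_smul_qtwistAux, wpart_plaq, bpart_plaq, twist_plaq, sum_four_signed, two_smul_quad, commSum_four]
  simp only [plaq, ctwistAux_consW, ctwistAux_consB, ctwistAux_nil, twistAux_consW, twistAux_consB, twistAux_nil, wpart_consW,
    wpart_consB, wpart_nil, List.sum_cons, List.sum_nil]
  simp only [← map_add, ← map_sub]
  refine trace_eq_zero_of_eq_csum 𝕜 τ hτ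
    [(B₁,
      4 * (B₂ * l * h) + 4 * (h * B₃ * l) + 4 * (h * l * B₂) + 4 * (l * B₃ * h) - 4 * (B₃ * l * h) - 4 * (h * B₂ * l) - 4 * (h * l * B₃) - 4 * (l * B₂ * h)),
    (B₂,
      4 * (B₂ * l * h) + 2 * (B₃ * h * l) + 2 * (B₄ * h * l) + 4 * (h * l * B₂) + 2 * (l * h * B₃) + 2 * (l * h * B₄) - 4 * (B₃ * l * h) - 4 * (h * B₄ * l) - 4 * (h * l * B₃) - 4 * (l * B₄ * h)),
    (B₃,
      4 * (B₃ * l * h) + 4 * (h * B₄ * l) + 4 * (l * B₄ * h) - 2 * (B₂ * l * h) - 4 * (B₃ * h * l) - 2 * (B₄ * h * l) - 2 * (h * l * B₂) - 2 * (l * h * B₄)),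
    (B₄,
      2 * (B₃ * l * h) + 2 * (h * l * B₃) - 2 * (B₂ * l * h) - 2 * (h * l * B₂)),
    (h,
      2 * (B₁ * B₂ * l) + 2 * (B₁ * l * B₃) + 4 * (B₂ * l * B₂) + 4 * (B₃ * B₃ * l) + 2 * (B₃ * l * B₁) + 2 * (B₃ * l * B₄) + 2 * (B₄ * l * B₃) + 2 * (l * B₂ * B₁) - 2 * (B₁ * B₃ * l) - 2 * (B₁ * l * B₂) - 2 * (B₂ * B₃ * l) - 2 * (B₂ * l * B₁) - 2 * (B₂ * l * B₄) - 4 * (B₃ * l * B₃) - 2 * (B₄ * l * B₂) - 2 * (l * B₃ * B₁) - 2 * (l * B₃ * B₂)),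
    (l,
      2 * (B₂ * B₃ * h) + 2 * (B₂ * B₄ * h) + 4 * (B₂ * h * B₂) + 4 * (B₃ * h * B₃) + 4 * (B₃ * h * B₄) + 4 * (B₄ * h * B₃) + 2 * (h * B₃ * B₂) + 2 * (h * B₄ * B₂) - 4 * (B₂ * h * B₃) - 4 * (B₂ * h * B₄) - 4 * (B₃ * B₃ * h) - 2 * (B₃ * B₄ * h) - 4 * (B₃ * h * B₂) - 4 * (B₄ * h * B₂) - 2 * (h * B₄ * B₃))] ?_
  simp only [csum_cons, csum_nil, br]
  noncomm_ring

set_option maxHeartbeats 2000000 in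
/-- **Entry `(b_4, x_4)`** of the order-`B²` Ward identity (`h` on `b₄ : x₁ → x₄` only, `λ = l` at the corner `x_4` only; `x_4 = b₊`): Hessian side `F_{2,2}`, `F_{2,1}`, `F_{2,0}`; current side `2·F_{1,2}(N₀)` + `2·F_{1,1}(N₁)`.  Collected difference 94 monomials, certificate 61. [folklore] -/
theorem ward22_b4_x4 (hτ : ∀ a b : 𝔸, τ (a * b) = τ (b * a)) :
    (4 : 𝕜) • τ (P22 𝕜 (plaq 0 0 l (h - l) B₁ B₂ B₃ B₄))
      - (4 : 𝕜) • τ (P22 𝕜 (plaq 0 0 0 h B₁ B₂ B₃ B₄))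
      - (4 : 𝕜) • τ (P22 𝕜 (plaq 0 0 l (-l) B₁ B₂ B₃ B₄))
      + ((4 : 𝕜) • τ (P21 𝕜 (plaq 0 0 0 (h + (l * B₄ - B₄ * l)) B₁ B₂ B₃ B₄))
          - (4 : 𝕜) • τ (P21 𝕜 (plaq 0 0 0 h B₁ B₂ B₃ B₄))
          - (4 : 𝕜) • τ (P21 𝕜 (plaq 0 0 0 (l * B₄ - B₄ * l) B₁ B₂ B₃ B₄)))
      + ((2 : 𝕜) • τ (quad 𝕜 (wpart (plaq 0 0 0 (h + (B₄ * (l * B₄ - B₄ * l) - (l * B₄ - B₄ * l) * B₄)) B₁ B₂ B₃ B₄)))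
          - (2 : 𝕜) • τ (quad 𝕜 (wpart (plaq 0 0 0 h B₁ B₂ B₃ B₄)))
          - (2 : 𝕜) • τ (quad 𝕜 (wpart (plaq 0 0 0 (B₄ * (l * B₄ - B₄ * l) - (l * B₄ - B₄ * l) * B₄) B₁ B₂ B₃ B₄)))) =
      (2 : 𝕜) • τ (P12 𝕜 (plaq 0 0 0 (h * l - l * h) B₁ B₂ B₃ B₄)) + (2 : 𝕜) • τ (P11 (plaq 0 0 0 ((l * B₄ - B₄ * l) * h - h * (l * B₄ - B₄ * l)) B₁ B₂ B₃ B₄)) := by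
  simp only [four_smul_trace_P22 𝕜 τ hτ, four_smul_trace_P21 𝕜 τ hτ, two_smul_trace_quad 𝕜 τ, two_smul_trace_P12 𝕜 τ,
    two_smul_trace_P11 𝕜 τ, two_smul_twist₂_plaq, two_smul_qtwistAux, wpart_plaq, bpart_plaq, twist_plaq, sum_four_signed,
    two_smul_quad, commSum_four]
  simp only [plaq, ctwistAux_consW, ctwistAux_consB, ctwistAux_nil, twistAux_consW, twistAux_consB, twistAux_nil, wpart_consW,
    wpart_consB, wpart_nil, List.sum_cons, List.sum_nil]
  simp only [← map_add, ← map_sub]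
  refine trace_eq_of_sub_eq_csum 𝕜 τ hτ
    [(B₁,
      B₁ * h * l + 2 * (B₂ * h * l) + 2 * (B₃ * l * h) + 4 * (h * B₄ * l) + 2 * (h * l * B₃) + 4 * (l * B₄ * h) + l * h * B₁ + 2 * (l * h * B₂) - B₁ * l * h - 2 * (B₂ * l * h) - 2 * (B₃ * h * l) - 2 * (B₄ * h * l) - 2 * (B₄ * l * h) - h * l * B₁ - 2 * (h * l * B₂) - 2 * (h * l * B₄) - 2 * (l * h * B₃) - 2 * (l * h * B₄)),
    (B₂,
      B₂ * h * l + 2 * (B₃ * l * h) + 4 * (h * B₄ * l) + 2 * (h * l * B₃) + 4 * (l * B₄ * h) + l * h * B₂ - B₂ * l * h - 2 * (B₃ * h * l) - 2 * (B₄ * h * l) - 2 * (B₄ * l * h) - h * l * B₂ - 2 * (h * l * B₄) - 2 * (l * h * B₃) - 2 * (l * h * B₄)),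
    (B₃,
      B₃ * h * l + 2 * (B₄ * h * l) + 2 * (B₄ * l * h) + 2 * (h * l * B₄) + l * h * B₃ + 2 * (l * h * B₄) - B₃ * l * h - 4 * (h * B₄ * l) - h * l * B₃ - 4 * (l * B₄ * h)),
    (B₄,
      3 * (B₄ * l * h) + l * h * B₄ - 2 * (B₄ * h * l)),
    (h,
      2 * (B₁ * l * B₄) + 2 * (B₂ * l * B₄) + 2 * (B₃ * B₄ * l) + 3 * (B₄ * B₄ * l) + 2 * (B₄ * l * B₁) + 2 * (B₄ * l * B₂) + 2 * (l * B₄ * B₃) - 2 * (B₁ * B₄ * l) - 2 * (B₂ * B₄ * l) - 2 * (B₃ * l * B₄) - 2 * (B₄ * l * B₃) - 2 * (B₄ * l * B₄) - 2 * (l * B₄ * B₁) - 2 * (l * B₄ * B₂)),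
    (l,
      4 * (B₄ * h * B₄) - 3 * (B₄ * B₄ * h))] ?_
  simp only [csum_cons, csum_nil, br]
  noncomm_ring

end Entries

end Literature.MathematicalPhysics.QuantumFieldTheory.Balaban1983to89.Beta.WilsonWardEntries2
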